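import Summits.QuantumFields.YangMills.Theorems.AlphaInputsT3ACv3NewtonLiftRegional
import HarnessLib

/-!
# `AlphaInputsT3ACv3NewtonLiftRegionalWindow` — STRATEGY B for 2′, the (FL) row under OWNER RULING g24-№4, item (E′): **THE REGIONAL NEWTON LIFT END-TO-END OVER DISPLAYED INPUTS,
# WITH THE WINDOW BOOKKEEPING `dist1 ≤ B·ε·L^{−2k}`** — the exact `k`-fold lift on the constrained coarse set `C` together with its plaquette clause on a set `Pl` of finest plaquettes,
# from (α) a displayed START (plaquettes `≤ δ₀` on `Pl`, stencil gauges `σ_c` with flatness `η`, plaquette gauges `g_q` with flatness `η_p`, defect `η₀` on `C`) and (β) a displayed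
# ABSTRACT kernel certificate (`𝔰𝔲`-valuedness, sup row `C_R∕L^k`, framed approximate right inverse `κ`, curl row `C_curl∕L^{2k}` in the gauges `g_q`); then the scaling
# `δ₀ = B₀·εL^{−2k}`, `η₀ = A₀·ε`, `η_p = A₁·εL^{−k}` gives `dist1 U(∂q) ≤ B·ε·L^{−2k}` with `B = B₀ + 4C_curl A₀ + 64C_R A₁A₀ + 256C_R²A₀²` ABSOLUTE — lane `pub-balaban3d` ∕ cell
# `ym3-torus`, seat `ym-ust-19936-w4` (g2)

WHY (cell `ym3-torus` 2026-08-28: ★★OWNER g25 03:13Z «★w4-19936 g2: (E′) = item (3) WINDOW BOOKKEEPING `dist1 < B·ε·L^{−2k}` from `dist1_plaqHol_regional_le` + a displayed START plaquette bound +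
a displayed kernel curl row (kernel-abstract), then the end-to-end corollary over (D)'s ABSTRACT certificate»; ★w1-19936 g2 LEAD 03:24:30Z «the displayed START plaquette bound you consume
is literally the conclusion of `dist1_plaqHol_startU_le`: `∀ q ∈ plaqsIn 0 Ω, dist1 (plaqHol U₀ q) ≤ δ₀`, `δ₀ = O(ε′·L^{−2k})`; `hU₀` from ★w2's `exists_flat_gauge_on_anchoredUnion` with
`η = O(ε′L^{−k})`; `hV` (η₀) from (S6)»).  (D) `exists_exact_lift_regional_allL` (this seat, p600658) gives the exact lift with `‖u‖ ≤ 4η₀`, `‖a_b‖ ≤ 4C_Rη₀∕L^k`, and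
`dist1_plaqHol_regional_le` its plaquette clause in a gauge.  THIS FILE is the consumer-facing composition:
* §1 ★★★ `exists_exact_lift_regional_plaq_allL` — (D) + the plaquette clause on EVERY `q ∈ Pl`: `dist1 U(∂q) ≤ δ₀ + (C_curl∕(L^k)²)·4η₀ + 16η_p·(4C_Rη₀∕L^k) + 16(4C_Rη₀∕L^k)²`.
* §2 ★★ `window_bookkeeping` (pure arithmetic) and ★★★ `exists_exact_lift_regional_window_allL` — under the START∕kernel scalings `δ₀ ≤ B₀·ε∕(L^k)²`, `η₀ ≤ A₀·ε`, `η_p ≤ A₁·ε∕L^k`,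
  `ε ≤ 1`: `dist1 U(∂q) ≤ (B₀ + 4C_curl A₀ + 64C_R A₁A₀ + 256C_R²A₀²)·ε∕(L^k)²` on `Pl` — the `hLift` plaquette clause's shape with an ABSOLUTE constant (no `k`, no `L`, no volume).
HONEST FRAMING.  Every analytic input is DISPLAYED: the START ((S5)∕(S6), LEAD ∕ ★w2 ∕ ★w5 ∕ ★alpha-2), the kernel certificate ((r1-ob) `obLift`: ★alpha-2 exactness∕bounds → port →
`…NewtonLiftTwistedKernel` rows), the smallness rows; `hLift` itself (the binder of `…v3InnerLiftFromRegionalThm1` at `C = bondsIn k Ω`, `Pl = plaqsIn 0 Ω`, `ℰp`, `SU(2)`) is the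
specialisation of §2 to those inputs and is NOT claimed here; the stub 2′χ, the crux `HistoryTailL` and any gap are NOT claimed; count-neutral helper toward R3 2′ (items 19936∕19935);
registry untouched; nothing about d = 4, the continuum, or a mass gap; YM₃ on T³ is rung R3, not Clay.

References: T. Bałaban, Commun. Math. Phys. 102 (1985) 277–309 [Balaban1985Variational] (Thm 1 (8) p.279, (11)–(15) pp.279–280); CMP 98 (1985) 17–51 [Balaban1985Averaging] ((8)–(13)
pp.18–19, (19)–(23) p.21, Props. 4–5 pp.38–42); CMP 102 (1985) 255–275 [Balaban1985UV3] ((40)–(42) p.266).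
-/

set_option autoImplicit false

noncomputable section

open scoped Matrix.Norms.L2Operator
open NormedSpace
namespace Summit.QuantumFields.YangMills.Theorems.NewtonLiftFramed

open Literature.MathematicalPhysics.QuantumFieldTheory.Balaban1983to89
open Literature.MathematicalPhysics.QuantumFieldTheory.Balaban1983to89.T4AdjointCovarianceUnitary (lieSU)
open Literature.MathematicalPhysics.QuantumFieldTheory.Balaban1983to89.B5Eq118OneStroke (iterBlockOf)
open T4Continuum BlockAveraging ExpMeanLog
open Summit.QuantumFields.YangMills.Theorems.LinearLiftMatrix (linAvgIterM curlM)

variable {n : Type*} [Fintype n] [DecidableEq n] [Nonempty n] {P : Params}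

/-! ## §1 The regional lift with its plaquette clause on a set of finest plaquettes -/

/-- **★★★ THE REGIONAL NEWTON LIFT WITH ITS PLAQUETTE CLAUSE, ABSTRACT KERNEL, EVERY `L ≥ 2`.**  The data and hypotheses of `exists_exact_lift_regional_allL` (constrained set `C`, stencil
gauges `σ`, stencils `N`, `U₀`, `V`, kernel `R₀` with its rows (α)(β)(γ), radius and smallness) PLUS: a set `Pl` of finest plaquettes, plaquette gauges `g : Plaq P 0 → GaugeTransf P 0 SU(n)`
with `‖(U₀^{g_q})_b − 1‖ ≤ η_p` on the four bonds of every `q ∈ Pl`, the START's plaquette bound `dist1 U₀(∂q) ≤ δ₀` on `Pl`, and the kernel's CURL ROW in the gauges `g_q`: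
`‖curl(b ↦ g_q(b₋)(R₀ u)_b g_q(b₋)*)(q)‖ ≤ (C_curl∕(L^k)²)·‖u‖` for `𝔰𝔲`-valued `u` supported on `C`.  THEN, besides the exact lift (`u`, `a = R₀ u`, `U = e^{a}U₀`, `Ū^{(k)} = V` on `C`,
`‖u‖ ≤ 4η₀`, `‖a_b‖ ≤ 4C_Rη₀∕L^k`): for every `q ∈ Pl`, `dist1 U(∂q) ≤ δ₀ + (C_curl∕(L^k)²)·(4η₀) + 16η_p·(4C_Rη₀∕L^k) + 16·(4C_Rη₀∕L^k)²`.
[cite: Balaban1985Variational, Thm 1 (8) p.279, (11)–(15) pp.279–280; Balaban1985Averaging, (8)–(13) pp.18–19, Props. 4–5 pp.38–42] -/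
theorem exists_exact_lift_regional_plaq_allL {k : ℕ} (hk : k ≤ P.m + P.K) (C : Set (PBond P k))
    (σ : PBond P k → GaugeTransf P 0 (Matrix.specialUnitaryGroup n ℂ)) (N : PBond P k → Set (Site P 0))
    (hN : ∀ c ∈ C, ∀ x : Site P 0, (iterBlockOf k x = c.src ∨ iterBlockOf k x = c.tgt) → x ∈ N c)
    (U₀ : GaugeField P 0 (Matrix.specialUnitaryGroup n ℂ)) (V : GaugeField P k (Matrix.specialUnitaryGroup n ℂ))
    (R₀ : (PBond P k → Matrix n n ℂ) →ₗ[ℝ] (PBond P 0 → Matrix n n ℂ))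
    {r η η₀ CR κ : ℝ} (hr : 0 < r) (hr4 : r ≤ 1 / 4) (hη : 0 ≤ η) (hη₀ : 0 ≤ η₀) (hCR : 0 < CR) (hκ : 0 ≤ κ)
    (hU₀ : ∀ c ∈ C, ∀ b : PBond P 0, b.src ∈ N c → b.tgt ∈ N c → ‖((GaugeField.gaugeAct (σ c) U₀ b : Matrix.specialUnitaryGroup n ℂ) : Matrix n n ℂ) - 1‖ ≤ η)
    (hV : ∀ c ∈ C, ‖((Averaging.iter (fun i => blockAvg (P := P) (j := i) (expMeanLogSU (n := n))) k U₀ c : Matrix.specialUnitaryGroup n ℂ) : Matrix n n ℂ) *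
        star ((V c : Matrix.specialUnitaryGroup n ℂ) : Matrix n n ℂ) - 1‖ ≤ η₀)
    (hRS : ∀ u : PBond P k → Matrix n n ℂ, (∀ c, u c ∈ lieSU n) → (∀ c, c ∉ C → u c = 0) → ∀ b, R₀ u b ∈ lieSU n)
    (hRn : ∀ u : PBond P k → Matrix n n ℂ, (∀ c, u c ∈ lieSU n) → (∀ c, c ∉ C → u c = 0) → ‖R₀ u‖ ≤ (CR / (P.L : ℝ) ^ k) * ‖u‖)
    (hRinv : ∀ u : PBond P k → Matrix n n ℂ, (∀ c, u c ∈ lieSU n) → (∀ c, c ∉ C → u c = 0) → ∀ c ∈ C,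
      ‖star (transfUp (σ c) k c.src : Matrix n n ℂ) * linAvgIterM k (fun b => ((σ c b.src : Matrix.specialUnitaryGroup n ℂ) : Matrix n n ℂ) * R₀ u b * star (σ c b.src : Matrix n n ℂ)) c *
          (transfUp (σ c) k c.src : Matrix n n ℂ) - u c‖ ≤ κ * ‖u‖)
    (h5200 : (((P.d : ℝ) + 1) * ((18 : ℝ) ^ P.d * (2 + ((P.d : ℝ) + 1) * (18 : ℝ) ^ P.d)) * (5200 * (((P.d + 2) * P.L : ℕ) : ℝ) ^ 2) / ((P.L : ℝ) * ((P.L : ℝ) - 1))) *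
      ((((P.d : ℝ) + 1) * (P.L : ℝ) ^ k * (4 * r)) + (((P.d : ℝ) + 1) * (P.L : ℝ) ^ k * (2 * r + η))) ≤ 1)
    (h200 : 200 * (((P.d + 2) * P.L : ℕ) : ℝ) * ((((P.d : ℝ) + 1) * (P.L : ℝ) ^ k * (4 * r)) + (((P.d : ℝ) + 1) * (P.L : ℝ) ^ k * (2 * r + η))) ≤ 1)
    (hNδ : 4 * (((P.d + 2) * P.L : ℕ) : ℝ) *
      ((((P.d : ℝ) + 1) * (P.L : ℝ) ^ k * (4 * r)) + (((P.d : ℝ) + 1) * (P.L : ℝ) ^ k * (2 * r + η))) < deltaSU n)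
    (hρD : 2 * ((((P.d : ℝ) + 1) * (P.L : ℝ) ^ k * (2 * r))) + η₀ ≤ 1 / 4)
    (hρπ : (Fintype.card n : ℝ) * (2 * ((((P.d : ℝ) + 1) * (P.L : ℝ) ^ k * (2 * r))) + η₀) < Real.pi)
    (hcontr : κ + ((P.d : ℝ) + 1) * CR *
      (8 * (2 * ((((P.d : ℝ) + 1) * (P.L : ℝ) ^ k * (2 * r))) + η₀) +
          2 * (((P.d : ℝ) + 1) * ((18 : ℝ) ^ P.d * (2 + ((P.d : ℝ) + 1) * (18 : ℝ) ^ P.d)) * (5200 * (((P.d + 2) * P.L : ℕ) : ℝ) ^ 2) / ((P.L : ℝ) * ((P.L : ℝ) - 1))) *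
            ((((P.d : ℝ) + 1) * (P.L : ℝ) ^ k * (4 * r)) + (((P.d : ℝ) + 1) * (P.L : ℝ) ^ k * (2 * r + η))) +
          (2 * r + η) + (2 * ((((P.d : ℝ) + 1) * (P.L : ℝ) ^ k * η)) + η₀)) ≤ 1 / 2)
    (hdef : 4 * CR * η₀ ≤ r * (P.L : ℝ) ^ k)
    -- the plaquette data
    (Pl : Set (Plaq P 0)) (g : Plaq P 0 → GaugeTransf P 0 (Matrix.specialUnitaryGroup n ℂ)) {ηp δ₀ Ccurl : ℝ} (hCcurl : 0 ≤ Ccurl)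
    (hU₀P : ∀ q ∈ Pl,
      ‖((GaugeField.gaugeAct (g q) U₀ ⟨q.src, q.μ⟩ : Matrix.specialUnitaryGroup n ℂ) : Matrix n n ℂ) - 1‖ ≤ ηp ∧
      ‖((GaugeField.gaugeAct (g q) U₀ ⟨q.src.shift q.μ, q.ν⟩ : Matrix.specialUnitaryGroup n ℂ) : Matrix n n ℂ) - 1‖ ≤ ηp ∧
      ‖((GaugeField.gaugeAct (g q) U₀ ⟨q.src.shift q.ν, q.μ⟩ : Matrix.specialUnitaryGroup n ℂ) : Matrix n n ℂ) - 1‖ ≤ ηp ∧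
      ‖((GaugeField.gaugeAct (g q) U₀ ⟨q.src, q.ν⟩ : Matrix.specialUnitaryGroup n ℂ) : Matrix n n ℂ) - 1‖ ≤ ηp)
    (hstart : ∀ q ∈ Pl, GaugeGroup.dist1 (GaugeField.plaqHol U₀ q) ≤ δ₀)
    (hRcurl : ∀ u : PBond P k → Matrix n n ℂ, (∀ c, u c ∈ lieSU n) → (∀ c, c ∉ C → u c = 0) → ∀ q ∈ Pl,
      ‖curlM (fun b : PBond P 0 => ((g q b.src : Matrix.specialUnitaryGroup n ℂ) : Matrix n n ℂ) * R₀ u b * star (g q b.src : Matrix n n ℂ)) q.src q.μ q.ν‖ ≤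
        (Ccurl / ((P.L : ℝ) ^ k) ^ 2) * ‖u‖) :
    ∃ (U : GaugeField P 0 (Matrix.specialUnitaryGroup n ℂ)) (u : PBond P k → Matrix n n ℂ) (a : PBond P 0 → Matrix n n ℂ),
      (∀ c, u c ∈ lieSU n) ∧ (∀ c, c ∉ C → u c = 0) ∧ ‖u‖ ≤ 4 * η₀ ∧ a = R₀ u ∧ (∀ b, a b ∈ lieSU n) ∧
      (∀ b, ‖a b‖ ≤ 4 * CR * η₀ / (P.L : ℝ) ^ k) ∧
      (∀ b, ((U b : Matrix.specialUnitaryGroup n ℂ) : Matrix n n ℂ) = exp (a b) * (U₀ b : Matrix n n ℂ)) ∧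
      (∀ c ∈ C, Averaging.iter (fun i => blockAvg (P := P) (j := i) (expMeanLogSU (n := n))) k U c = V c) ∧
      (∀ q ∈ Pl, GaugeGroup.dist1 (GaugeField.plaqHol U q) ≤
        δ₀ + (Ccurl / ((P.L : ℝ) ^ k) ^ 2) * (4 * η₀) + 16 * ηp * (4 * CR * η₀ / (P.L : ℝ) ^ k) + 16 * (4 * CR * η₀ / (P.L : ℝ) ^ k) ^ 2) := by
  obtain ⟨U, u, a, huS, hu0, hu4, ha, haS, haδ, hU, hex⟩ := exists_exact_lift_regional_allL hk C σ N hN U₀ V R₀ hr hr4 hη hη₀ hCR hκ hU₀ hV hRS hRn hRinv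
    h5200 h200 hNδ hρD hρπ hcontr hdef
  have hLk : (0 : ℝ) < (P.L : ℝ) ^ k := by have := P.L_pos; positivity
  set δ : ℝ := 4 * CR * η₀ / (P.L : ℝ) ^ k with hδdef
  have hδ0 : 0 ≤ δ := by rw [hδdef]; positivity
  have hδr : δ ≤ r := by rw [hδdef, div_le_iff₀ hLk]; exact hdef
  have hδ4 : 4 * δ ≤ 1 := by linarith
  refine ⟨U, u, a, huS, hu0, hu4, ha, haS, haδ, hU, hex, fun q hq => ?_⟩
  obtain ⟨h₁, h₂, h₃, h₄⟩ := hU₀P q hq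
  have h := dist1_plaqHol_regional_le U₀ U R₀ u a ha haS hU hδ0 hδ4 hCcurl hu4 haδ q (g q) h₁ h₂ h₃ h₄ (hRcurl u huS hu0 q hq)
  linarith [hstart q hq]

/-! ## §2 The window bookkeeping -/

omit [Fintype n] [DecidableEq n] [Nonempty n] in
/-- **★★ THE WINDOW BOOKKEEPING** (pure arithmetic): with `w = ε∕(L^k)²`, `0 ≤ ε ≤ 1`, `1 ≤ L^k`, the START∕defect∕gauge scalings `δ₀ ≤ B₀·w`, `0 ≤ η₀ ≤ A₀·ε`, `η_p ≤ A₁·ε∕L^k` and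
nonnegative `C_curl, C_R, A₀, A₁` give `δ₀ + (C_curl∕(L^k)²)·4η₀ + 16η_p·(4C_Rη₀∕L^k) + 16(4C_Rη₀∕L^k)² ≤ (B₀ + 4C_curl A₀ + 64C_R A₁A₀ + 256C_R²A₀²)·w` — an ABSOLUTE bracket.
[cite: Balaban1985Variational, (8) p.279, (13) p.280] -/
theorem window_bookkeeping {Lk ε δ₀ η₀ ηp B₀ A₀ A₁ CR Ccurl : ℝ} (hLk : 1 ≤ Lk) (hε : 0 ≤ ε) (hε1 : ε ≤ 1)
    (hA₀ : 0 ≤ A₀) (hA₁ : 0 ≤ A₁) (hCR : 0 ≤ CR) (hCcurl : 0 ≤ Ccurl) (hη₀ : 0 ≤ η₀)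
    (hδ₀ : δ₀ ≤ B₀ * (ε / Lk ^ 2)) (hη₀A : η₀ ≤ A₀ * ε) (hηpA : ηp ≤ A₁ * (ε / Lk)) :
    δ₀ + (Ccurl / Lk ^ 2) * (4 * η₀) + 16 * ηp * (4 * CR * η₀ / Lk) + 16 * (4 * CR * η₀ / Lk) ^ 2 ≤
      (B₀ + 4 * Ccurl * A₀ + 64 * CR * A₁ * A₀ + 256 * CR ^ 2 * A₀ ^ 2) * (ε / Lk ^ 2) := by
  have hLk0 : 0 < Lk := by linarith
  have hw : 0 ≤ ε / Lk ^ 2 := by positivity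
  -- term 2
  have t2 : (Ccurl / Lk ^ 2) * (4 * η₀) ≤ 4 * Ccurl * A₀ * (ε / Lk ^ 2) := by
    have : (Ccurl / Lk ^ 2) * (4 * η₀) = 4 * Ccurl * (η₀ / Lk ^ 2) := by ring
    rw [this, show 4 * Ccurl * A₀ * (ε / Lk ^ 2) = 4 * Ccurl * (A₀ * ε / Lk ^ 2) by ring]
    exact mul_le_mul_of_nonneg_left (div_le_div_of_nonneg_right hη₀A (by positivity)) (by positivity)
  -- term 3
  have t3 : 16 * ηp * (4 * CR * η₀ / Lk) ≤ 64 * CR * A₁ * A₀ * (ε / Lk ^ 2) := by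
    have e : 16 * ηp * (4 * CR * η₀ / Lk) = 64 * CR * (ηp * η₀ / Lk) := by ring
    have hprod : ηp * η₀ ≤ (A₁ * (ε / Lk)) * (A₀ * ε) := mul_le_mul hηpA hη₀A hη₀ (by positivity)
    have hε2 : (A₁ * (ε / Lk)) * (A₀ * ε) ≤ A₁ * A₀ * (ε / Lk) := by
      have : (A₁ * (ε / Lk)) * (A₀ * ε) = A₁ * A₀ * (ε / Lk) * ε := by ring
      rw [this]; exact mul_le_of_le_one_right (by positivity) hε1
    rw [e, show 64 * CR * A₁ * A₀ * (ε / Lk ^ 2) = 64 * CR * (A₁ * A₀ * (ε / Lk) / Lk) by field_simp]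
    exact mul_le_mul_of_nonneg_left (div_le_div_of_nonneg_right (hprod.trans hε2) hLk0.le) (by positivity)
  -- term 4
  have t4 : 16 * (4 * CR * η₀ / Lk) ^ 2 ≤ 256 * CR ^ 2 * A₀ ^ 2 * (ε / Lk ^ 2) := by
    have e : 16 * (4 * CR * η₀ / Lk) ^ 2 = 256 * CR ^ 2 * (η₀ ^ 2 / Lk ^ 2) := by field_simp; ring
    have hsq : η₀ ^ 2 ≤ A₀ ^ 2 * ε := by
      have h1 : η₀ ^ 2 ≤ (A₀ * ε) ^ 2 := pow_le_pow_left₀ hη₀ hη₀A 2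
      have h2 : (A₀ * ε) ^ 2 = A₀ ^ 2 * ε * ε := by ring
      rw [h2] at h1
      exact h1.trans (mul_le_of_le_one_right (by positivity) hε1)
    rw [e, show 256 * CR ^ 2 * A₀ ^ 2 * (ε / Lk ^ 2) = 256 * CR ^ 2 * (A₀ ^ 2 * ε / Lk ^ 2) by ring]
    exact mul_le_mul_of_nonneg_left (div_le_div_of_nonneg_right hsq (by positivity)) (by positivity)
  have esum : (B₀ + 4 * Ccurl * A₀ + 64 * CR * A₁ * A₀ + 256 * CR ^ 2 * A₀ ^ 2) * (ε / Lk ^ 2) =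
      B₀ * (ε / Lk ^ 2) + 4 * Ccurl * A₀ * (ε / Lk ^ 2) + 64 * CR * A₁ * A₀ * (ε / Lk ^ 2) + 256 * CR ^ 2 * A₀ ^ 2 * (ε / Lk ^ 2) := by ring
  rw [esum]
  linarith

/-- **★★★ THE REGIONAL NEWTON LIFT WITH THE `hLift`-SHAPED PLAQUETTE WINDOW** (every `L ≥ 2`, `k ≤ m + K`).  Everything as in `exists_exact_lift_regional_plaq_allL`, and the inputs on
the natural scales of the lane: START plaquettes `δ₀ ≤ B₀·ε∕(L^k)²`, defect `η₀ ≤ A₀·ε`, plaquette-gauge flatness `η_p ≤ A₁·ε∕L^k`, `0 ≤ ε ≤ 1`.  THEN the exact lift `U = e^{R₀u}U₀`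
(`Ū^{(k)} = V` on `C`) satisfies, for every `q ∈ Pl`, `dist1 U(∂q) ≤ (B₀ + 4C_curl A₀ + 64C_R A₁A₀ + 256C_R²A₀²)·ε∕(L^k)²` — the plaquette clause of the `hLift` binder with an ABSOLUTE
constant (no `k`, `L` or volume), over a displayed START and a displayed kernel certificate. [cite: Balaban1985Variational, Thm 1 (8) p.279, (11)–(15) pp.279–280; Balaban1985UV3, (40)–(42) p.266] -/
theorem exists_exact_lift_regional_window_allL {k : ℕ} (hk : k ≤ P.m + P.K) (C : Set (PBond P k))
    (σ : PBond P k → GaugeTransf P 0 (Matrix.specialUnitaryGroup n ℂ)) (N : PBond P k → Set (Site P 0))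
    (hN : ∀ c ∈ C, ∀ x : Site P 0, (iterBlockOf k x = c.src ∨ iterBlockOf k x = c.tgt) → x ∈ N c)
    (U₀ : GaugeField P 0 (Matrix.specialUnitaryGroup n ℂ)) (V : GaugeField P k (Matrix.specialUnitaryGroup n ℂ))
    (R₀ : (PBond P k → Matrix n n ℂ) →ₗ[ℝ] (PBond P 0 → Matrix n n ℂ))
    {r η η₀ CR κ : ℝ} (hr : 0 < r) (hr4 : r ≤ 1 / 4) (hη : 0 ≤ η) (hη₀ : 0 ≤ η₀) (hCR : 0 < CR) (hκ : 0 ≤ κ)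
    (hU₀ : ∀ c ∈ C, ∀ b : PBond P 0, b.src ∈ N c → b.tgt ∈ N c → ‖((GaugeField.gaugeAct (σ c) U₀ b : Matrix.specialUnitaryGroup n ℂ) : Matrix n n ℂ) - 1‖ ≤ η)
    (hV : ∀ c ∈ C, ‖((Averaging.iter (fun i => blockAvg (P := P) (j := i) (expMeanLogSU (n := n))) k U₀ c : Matrix.specialUnitaryGroup n ℂ) : Matrix n n ℂ) *
        star ((V c : Matrix.specialUnitaryGroup n ℂ) : Matrix n n ℂ) - 1‖ ≤ η₀)
    (hRS : ∀ u : PBond P k → Matrix n n ℂ, (∀ c, u c ∈ lieSU n) → (∀ c, c ∉ C → u c = 0) → ∀ b, R₀ u b ∈ lieSU n)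
    (hRn : ∀ u : PBond P k → Matrix n n ℂ, (∀ c, u c ∈ lieSU n) → (∀ c, c ∉ C → u c = 0) → ‖R₀ u‖ ≤ (CR / (P.L : ℝ) ^ k) * ‖u‖)
    (hRinv : ∀ u : PBond P k → Matrix n n ℂ, (∀ c, u c ∈ lieSU n) → (∀ c, c ∉ C → u c = 0) → ∀ c ∈ C,
      ‖star (transfUp (σ c) k c.src : Matrix n n ℂ) * linAvgIterM k (fun b => ((σ c b.src : Matrix.specialUnitaryGroup n ℂ) : Matrix n n ℂ) * R₀ u b * star (σ c b.src : Matrix n n ℂ)) c *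
          (transfUp (σ c) k c.src : Matrix n n ℂ) - u c‖ ≤ κ * ‖u‖)
    (h5200 : (((P.d : ℝ) + 1) * ((18 : ℝ) ^ P.d * (2 + ((P.d : ℝ) + 1) * (18 : ℝ) ^ P.d)) * (5200 * (((P.d + 2) * P.L : ℕ) : ℝ) ^ 2) / ((P.L : ℝ) * ((P.L : ℝ) - 1))) *
      ((((P.d : ℝ) + 1) * (P.L : ℝ) ^ k * (4 * r)) + (((P.d : ℝ) + 1) * (P.L : ℝ) ^ k * (2 * r + η))) ≤ 1)
    (h200 : 200 * (((P.d + 2) * P.L : ℕ) : ℝ) * ((((P.d : ℝ) + 1) * (P.L : ℝ) ^ k * (4 * r)) + (((P.d : ℝ) + 1) * (P.L : ℝ) ^ k * (2 * r + η))) ≤ 1)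
    (hNδ : 4 * (((P.d + 2) * P.L : ℕ) : ℝ) *
      ((((P.d : ℝ) + 1) * (P.L : ℝ) ^ k * (4 * r)) + (((P.d : ℝ) + 1) * (P.L : ℝ) ^ k * (2 * r + η))) < deltaSU n)
    (hρD : 2 * ((((P.d : ℝ) + 1) * (P.L : ℝ) ^ k * (2 * r))) + η₀ ≤ 1 / 4)
    (hρπ : (Fintype.card n : ℝ) * (2 * ((((P.d : ℝ) + 1) * (P.L : ℝ) ^ k * (2 * r))) + η₀) < Real.pi)
    (hcontr : κ + ((P.d : ℝ) + 1) * CR *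
      (8 * (2 * ((((P.d : ℝ) + 1) * (P.L : ℝ) ^ k * (2 * r))) + η₀) +
          2 * (((P.d : ℝ) + 1) * ((18 : ℝ) ^ P.d * (2 + ((P.d : ℝ) + 1) * (18 : ℝ) ^ P.d)) * (5200 * (((P.d + 2) * P.L : ℕ) : ℝ) ^ 2) / ((P.L : ℝ) * ((P.L : ℝ) - 1))) *
            ((((P.d : ℝ) + 1) * (P.L : ℝ) ^ k * (4 * r)) + (((P.d : ℝ) + 1) * (P.L : ℝ) ^ k * (2 * r + η))) +
          (2 * r + η) + (2 * ((((P.d : ℝ) + 1) * (P.L : ℝ) ^ k * η)) + η₀)) ≤ 1 / 2)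
    (hdef : 4 * CR * η₀ ≤ r * (P.L : ℝ) ^ k)
    (Pl : Set (Plaq P 0)) (g : Plaq P 0 → GaugeTransf P 0 (Matrix.specialUnitaryGroup n ℂ)) {ηp δ₀ Ccurl : ℝ} (hCcurl : 0 ≤ Ccurl)
    (hU₀P : ∀ q ∈ Pl,
      ‖((GaugeField.gaugeAct (g q) U₀ ⟨q.src, q.μ⟩ : Matrix.specialUnitaryGroup n ℂ) : Matrix n n ℂ) - 1‖ ≤ ηp ∧
      ‖((GaugeField.gaugeAct (g q) U₀ ⟨q.src.shift q.μ, q.ν⟩ : Matrix.specialUnitaryGroup n ℂ) : Matrix n n ℂ) - 1‖ ≤ ηp ∧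
      ‖((GaugeField.gaugeAct (g q) U₀ ⟨q.src.shift q.ν, q.μ⟩ : Matrix.specialUnitaryGroup n ℂ) : Matrix n n ℂ) - 1‖ ≤ ηp ∧
      ‖((GaugeField.gaugeAct (g q) U₀ ⟨q.src, q.ν⟩ : Matrix.specialUnitaryGroup n ℂ) : Matrix n n ℂ) - 1‖ ≤ ηp)
    (hstart : ∀ q ∈ Pl, GaugeGroup.dist1 (GaugeField.plaqHol U₀ q) ≤ δ₀)
    (hRcurl : ∀ u : PBond P k → Matrix n n ℂ, (∀ c, u c ∈ lieSU n) → (∀ c, c ∉ C → u c = 0) → ∀ q ∈ Pl,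
      ‖curlM (fun b : PBond P 0 => ((g q b.src : Matrix.specialUnitaryGroup n ℂ) : Matrix n n ℂ) * R₀ u b * star (g q b.src : Matrix n n ℂ)) q.src q.μ q.ν‖ ≤
        (Ccurl / ((P.L : ℝ) ^ k) ^ 2) * ‖u‖)
    -- the scales
    {ε B₀ A₀ A₁ : ℝ} (hε : 0 ≤ ε) (hε1 : ε ≤ 1) (hA₀ : 0 ≤ A₀) (hA₁ : 0 ≤ A₁)
    (hδ₀ : δ₀ ≤ B₀ * (ε / ((P.L : ℝ) ^ k) ^ 2)) (hη₀A : η₀ ≤ A₀ * ε) (hηpA : ηp ≤ A₁ * (ε / (P.L : ℝ) ^ k)) :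
    ∃ (U : GaugeField P 0 (Matrix.specialUnitaryGroup n ℂ)) (u : PBond P k → Matrix n n ℂ) (a : PBond P 0 → Matrix n n ℂ),
      (∀ c, u c ∈ lieSU n) ∧ (∀ c, c ∉ C → u c = 0) ∧ ‖u‖ ≤ 4 * η₀ ∧ a = R₀ u ∧ (∀ b, a b ∈ lieSU n) ∧
      (∀ b, ‖a b‖ ≤ 4 * CR * η₀ / (P.L : ℝ) ^ k) ∧
      (∀ b, ((U b : Matrix.specialUnitaryGroup n ℂ) : Matrix n n ℂ) = exp (a b) * (U₀ b : Matrix n n ℂ)) ∧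
      (∀ c ∈ C, Averaging.iter (fun i => blockAvg (P := P) (j := i) (expMeanLogSU (n := n))) k U c = V c) ∧
      (∀ q ∈ Pl, GaugeGroup.dist1 (GaugeField.plaqHol U q) ≤ (B₀ + 4 * Ccurl * A₀ + 64 * CR * A₁ * A₀ + 256 * CR ^ 2 * A₀ ^ 2) * (ε / ((P.L : ℝ) ^ k) ^ 2)) := by
  obtain ⟨U, u, a, huS, hu0, hu4, ha, haS, haδ, hU, hex, hplaq⟩ := exists_exact_lift_regional_plaq_allL hk C σ N hN U₀ V R₀ hr hr4 hη hη₀ hCR hκ hU₀ hV hRS hRn hRinv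
    h5200 h200 hNδ hρD hρπ hcontr hdef Pl g hCcurl hU₀P hstart hRcurl
  have hLk : (1 : ℝ) ≤ (P.L : ℝ) ^ k := one_le_pow₀ (by exact_mod_cast P.hL.2.le)
  refine ⟨U, u, a, huS, hu0, hu4, ha, haS, haδ, hU, hex, fun q hq => (hplaq q hq).trans ?_⟩
  exact window_bookkeeping hLk hε hε1 hA₀ hA₁ hCR.le hCcurl hη₀ hδ₀ hη₀A hηpA

end Summit.QuantumFields.YangMills.Theorems.NewtonLiftFramed

end
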